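import Summits.NavierStokesRegularity.NavierStokesRegularity.Theses.RellichScar
import Summits.NavierStokesRegularity.NavierStokesRegularity.Theorems.TypeIDSSLiouvilleConjecture
import Summits.NavierStokesRegularity.NavierStokesRegularity.Theorems.RellichScarSymmetricScarExistsSplit
import Summits.NavierStokesRegularity.NavierStokesRegularity.Theorems.RellichScarSymmetricScarExistsRdssWallBridge

/-!
# Crux `SymmetricScarExists` (stmt-NavierStokesRegularity-11718), line `rdss-screw-split`: the split against EXISTING items

Helper file of the line lead (c3; `--supports stmt-NavierStokesRegularity-11718`; theorems only).  The screw split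
`S ⇐ A ∧ B ∧ C` (glue `RdssSplit.symmetricScarExists_of_rdssSplit`, landed) has two children dominated by statements
that ALREADY exist as named items of the tree: `B = RdssScarRigidity ⇐ ScarRigidity` (route item
stmt-NavierStokesRegularity-11717; `RdssSplit.rdssScarRigidity_of_scarRigidity`) and `C = RdssApexFatal ⇐`
the canonical conjecture leaf `Summit.NavierStokesRegularity.NavierStokesRegularity.TypeIDSSLiouvilleConjecture`
(`RdssSplit.WallBridge.rdssApexFatal_of_typeIDSSLiouvilleConjecture`).  Composing, the crux reduces — modulo those
two EXISTING open items — to the single NEW statement `A = RdssScarSelection`: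

* `symmetricScarExists_of_rdssSplit_canonical : A → B → TypeIDSSLiouvilleConjecture → SymmetricScarExists`
  (split variant with `k = 3` whose third child is the canonical wall shared by the sub-problem's routes);
* `symmetricScarExists_of_rdssScarSelection_scarRigidity_wall : A → ScarRigidity → TypeIDSSLiouvilleConjecture →
  SymmetricScarExists` (split variant with ONE new child: the planner may file `A` alone, conditional on the two
  existing items).

Both are glue candidates (`--glue-by`) for the planner's `route edit --split SymmetricScarExists`.

References: Z. Bradshaw, T.-P. Tsai, Comm. PDE 42 (2017), §5 OP 5.1 [BradshawTsai2017CPDE]; T.-P. Tsai, GSM 192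
(2018), Conj. 8.8–8.9 [Tsai2018]; B. Pineau, V. Vicol, arXiv:2607.09619, Conj. 1.1 [PineauVicol2026].
-/

noncomputable section

open MeasureTheory Set Function Filter Topology TopologicalSpace Metric
open scoped NNReal ENNReal

namespace Summit.NavierStokesRegularity.NavierStokesRegularity.Theorems.SymmetricScarExists.RdssSplit

open Literature.Analysis.FluidPDE
open Summit.NavierStokesRegularity.NavierStokesRegularity.Theses.RellichScar
open Summit.NavierStokesRegularity.NavierStokesRegularity.Theorems.SymmetricScarExists.Negative

set_option linter.dupNamespace false

/-- **Screw split, canonical-wall variant**: `RdssScarSelection → RdssScarRigidity → TypeIDSSLiouvilleConjecture →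
SymmetricScarExists` — the landed glue with child C discharged from the canonical Type-I (R)DSS Liouville conjecture
by the landed wall bridge. [cite: BradshawTsai2017CPDE, §5 Open Problem 5.1] -/
theorem symmetricScarExists_of_rdssSplit_canonical :
    (∀ C : ℝ, (∃ (u : ℝ → EuclideanSpace ℝ (Fin 3) → EuclideanSpace ℝ (Fin 3)) (p : ℝ → EuclideanSpace ℝ (Fin 3) → ℝ) (G : ℝ → EuclideanSpace ℝ (Fin 3) → EuclideanSpace ℝ (Fin 3) →L[ℝ] EuclideanSpace ℝ (Fin 3)), IsSuitableWeakSolutionOn (slab (EuclideanSpace ℝ (Fin 3)) (Iio 0) isOpen_Iio) 1 0 u p ∧ HasWeakSpatialGradientOn (slab (EuclideanSpace ℝ (Fin 3)) (Iio 0) isOpen_Iio) u G ∧ typeIBound (Iio (0 : ℝ) ×ˢ univ) u p G < ⊤ ∧ HasTypeIDecay C u ∧ IsBackwardSingularPoint u 0) → ∃ (C' : ℝ) (u : ℝ → EuclideanSpace ℝ (Fin 3) → EuclideanSpace ℝ (Fin 3)) (p : ℝ → EuclideanSpace ℝ (Fin 3) → ℝ) (G : ℝ → EuclideanSpace ℝ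 (Fin 3) → EuclideanSpace ℝ (Fin 3) →L[ℝ] EuclideanSpace ℝ (Fin 3)), IsSuitableWeakSolutionOn (slab (EuclideanSpace ℝ (Fin 3)) (Iio 0) isOpen_Iio) 1 0 u p ∧ HasWeakSpatialGradientOn (slab (EuclideanSpace ℝ (Fin 3)) (Iio 0) isOpen_Iio) u G ∧ typeIBound (Iio (0 : ℝ) ×ˢ univ) u p G < ⊤ ∧ HasTypeIDecay C' u ∧ IsBackwardSingularPoint u 0 ∧ ((∃ c θ : ℝ, 1 < c ∧ ∀ K : Set (EuclideanSpace ℝ (Fin 3)), IsCompact K → (0 : EuclideanSpace ℝ (Fin 3)) ∉ K → Tendsto (fun δ : ℝ => eLpNorm (uncurry (fun t x => rotZ θ (nsRescale c u t (rotZ (-θ) x))) - uncurry u) ⊤ (volume.restrict (Ioo (-δ) 0 ×ˢ K))) (nhdsWithin 0 (Ioi 0)) (nhds 0)) ∨ (∀ θ : ℝ, ∀ K : Set (EuclideanSpace ℝ (Fin 3)), IsCompact K → (0 : EuclideanSpace ℝ (Fin 3)) ∉ K → Tendsto (fun δ : ℝ => eLpNorm (uncurry (fun t x => rotZ θ (u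 t (rotZ (-θ) x))) - uncurry u) ⊤ (volume.restrict (Ioo (-δ) 0 ×ˢ K))) (nhdsWithin 0 (Ioi 0)) (nhds 0)))) → (∀ (u : ℝ → EuclideanSpace ℝ (Fin 3) → EuclideanSpace ℝ (Fin 3)) (p : ℝ → EuclideanSpace ℝ (Fin 3) → ℝ) (G : ℝ → EuclideanSpace ℝ (Fin 3) → EuclideanSpace ℝ (Fin 3) →L[ℝ] EuclideanSpace ℝ (Fin 3)) (C c θ : ℝ), IsSuitableWeakSolutionOn (slab (EuclideanSpace ℝ (Fin 3)) (Iio 0) isOpen_Iio) 1 0 u p → HasWeakSpatialGradientOn (slab (EuclideanSpace ℝ (Fin 3)) (Iio 0) isOpen_Iio) u G → typeIBound (Iio (0 : ℝ) ×ˢ univ) u p G < ⊤ → HasTypeIDecay C u → IsBackwardSingularPoint u 0 → 1 < c → (∀ K : Set (EuclideanSpace ℝ (Fin 3)), IsCompact K → (0 : EuclideanSpace ℝ (Fin 3)) ∉ K → Tendsto (fun δ : ℝ => eLpNorm (uncurry (fun t x => rotZ θ (nsRescale c u t (rotZ (-θ) x))) - uncurry u) ⊤ (volume.restrict (Ioo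 (-δ) 0 ×ˢ K))) (nhdsWithin 0 (Ioi 0)) (nhds 0)) → uncurry (fun t x => rotZ θ (nsRescale c u t (rotZ (-θ) x))) =ᵐ[volume.restrict (Iio (0 : ℝ) ×ˢ univ)] uncurry u) → Summit.NavierStokesRegularity.NavierStokesRegularity.TypeIDSSLiouvilleConjecture → Summit.NavierStokesRegularity.NavierStokesRegularity.Theses.RellichScar.SymmetricScarExists := by
  intro hSel hRig hW
  exact symmetricScarExists_of_rdssSplit hSel hRig (WallBridge.rdssApexFatal_of_typeIDSSLiouvilleConjecture hW)

/-- **The crux modulo two EXISTING open items is the single new statement A**: `RdssScarSelection → ScarRigidity →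
TypeIDSSLiouvilleConjecture → SymmetricScarExists` (B from the sibling crux `ScarRigidity` by
`rdssScarRigidity_of_scarRigidity`, C from the canonical wall by the wall bridge). [cite: BradshawTsai2017CPDE, §5 Open Problem 5.1] -/
theorem symmetricScarExists_of_rdssScarSelection_scarRigidity_wall :
    (∀ C : ℝ, (∃ (u : ℝ → EuclideanSpace ℝ (Fin 3) → EuclideanSpace ℝ (Fin 3)) (p : ℝ → EuclideanSpace ℝ (Fin 3) → ℝ) (G : ℝ → EuclideanSpace ℝ (Fin 3) → EuclideanSpace ℝ (Fin 3) →L[ℝ] EuclideanSpace ℝ (Fin 3)), IsSuitableWeakSolutionOn (slab (EuclideanSpace ℝ (Fin 3)) (Iio 0) isOpen_Iio) 1 0 u p ∧ HasWeakSpatialGradientOn (slab (EuclideanSpace ℝ (Fin 3)) (Iio 0) isOpen_Iio) u G ∧ typeIBound (Iio (0 : ℝ) ×ˢ univ) u p G < ⊤ ∧ HasTypeIDecay C u ∧ IsBackwardSingularPoint u 0) → ∃ (C' : ℝ) (u : ℝ → EuclideanSpace ℝ (Fin 3) → EuclideanSpace ℝ (Fin 3)) (p : ℝ → EuclideanSpace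 ℝ (Fin 3) → ℝ) (G : ℝ → EuclideanSpace ℝ (Fin 3) → EuclideanSpace ℝ (Fin 3) →L[ℝ] EuclideanSpace ℝ (Fin 3)), IsSuitableWeakSolutionOn (slab (EuclideanSpace ℝ (Fin 3)) (Iio 0) isOpen_Iio) 1 0 u p ∧ HasWeakSpatialGradientOn (slab (EuclideanSpace ℝ (Fin 3)) (Iio 0) isOpen_Iio) u G ∧ typeIBound (Iio (0 : ℝ) ×ˢ univ) u p G < ⊤ ∧ HasTypeIDecay C' u ∧ IsBackwardSingularPoint u 0 ∧ ((∃ c θ : ℝ, 1 < c ∧ ∀ K : Set (EuclideanSpace ℝ (Fin 3)), IsCompact K → (0 : EuclideanSpace ℝ (Fin 3)) ∉ K → Tendsto (fun δ : ℝ => eLpNorm (uncurry (fun t x => rotZ θ (nsRescale c u t (rotZ (-θ) x))) - uncurry u) ⊤ (volume.restrict (Ioo (-δ) 0 ×ˢ K))) (nhdsWithin 0 (Ioi 0)) (nhds 0)) ∨ (∀ θ : ℝ, ∀ K : Set (EuclideanSpace ℝ (Fin 3)), IsCompact K → (0 : EuclideanSpace ℝ (Fin 3)) ∉ K → Tendsto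 (fun δ : ℝ => eLpNorm (uncurry (fun t x => rotZ θ (u t (rotZ (-θ) x))) - uncurry u) ⊤ (volume.restrict (Ioo (-δ) 0 ×ˢ K))) (nhdsWithin 0 (Ioi 0)) (nhds 0)))) → Summit.NavierStokesRegularity.NavierStokesRegularity.Theses.RellichScar.ScarRigidity → Summit.NavierStokesRegularity.NavierStokesRegularity.TypeIDSSLiouvilleConjecture → Summit.NavierStokesRegularity.NavierStokesRegularity.Theses.RellichScar.SymmetricScarExists := by
  intro hSel hSR hW
  exact symmetricScarExists_of_rdssSplit hSel (rdssScarRigidity_of_scarRigidity hSR)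
    (WallBridge.rdssApexFatal_of_typeIDSSLiouvilleConjecture hW)

end Summit.NavierStokesRegularity.NavierStokesRegularity.Theorems.SymmetricScarExists.RdssSplit

end
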